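import Summits.CriticalPhenomena.PercolationContinuityZ3.Theorems.Transplant.SkelPhiRootChainN
import HarnessLib

/-!
# N1 (the `{±1}` node), (R) column (N1-R-PLAN v2 §4 (R4), generic form; NEG-SCOPE B.15): THE ROOT RESIDUE FROM THE BRIDGE + A LONG RUN FOR ANY SCHEME —
# `Skelφ.rootOblTWAt_of_bridgeG`: `rootOblTWAt_of_bridge` (p288127) with the scheme `⟨cellGeomSG₂ G ψc P t Λ, q, δc⟩` replaced by an arbitrary `S : KSchA V ℕ`
# (root `t`, density `S.p`) and the three scheme-specific membership lemmas (`mem_U0root_of_footprint`, `mem_rootQ_of_footprint`, `mem_rootM_of_footprint`)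
# replaced by hypotheses: abstract footprint tests `FootOK`/`TgtOK : V → Prop` with `hUfoot`/`hMfoot`, and the seed inside the root cube `hAQ`.
# Purpose: ruling B.15 shrinks the node's arrival boxes (`cellGeomSG₂b … b₀`); the (R) chain is thereby scheme-agnostic and is instantiated at (R6) with
# whichever scheme of record and its footprint lemmas.  Proof = the p288127 proof verbatim with those three substitutions.

builds on p205010 (kernel theorem, internal audit signed; external expert review pending) — nothing in this file uses p205010; nothing here is a claim about the open node.
Lane `prim-bschramm`, seat `prim-bschramm-p3` (gen 9; design owner + (R) owner); helper file (`--supports stmt-CriticalPhenomena-4575 --as helper`).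
[cite: KozmaNitzan2024, §4 p. 27 (G₀), p. 28 ((32) at the root), Lemma 11 (pp. 22–23), Lemma 12 (pp. 23–25)] [cite: MartineauTassion2017, §3.2, §4.3]
-/

noncomputable section

open MeasureTheory ProbabilityTheory
open scoped ENNReal Classical

namespace Summit.CriticalPhenomena.PercolationContinuityZ3.Theorems

namespace Transplant

namespace Skelφ

open Literature.Probability.Percolation Literature.Probability.LatticeModels SimpleGraph GadgetSystem ProbeHistory HSiteScheme Contour KNCells
open Literature.Probability.Percolation.KozmaNitzan.Cells (oth sgOf stepVec_apply_fst)
open KNCells.KSchA KNLevels ChainPlanar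
open Literature.Barriers.CriticalPhenomena (graphBall mem_graphBall_self graphBall_mono)
open BoxProdZ2 (ConcRadiiG)
open Skel (winGraph RootOblTWAt)

variable {V : Type} [DecidableEq V] [Countable V] {G : SimpleGraph V} [G.LocallyFinite] {φ ψL : V → Site 2}

/-- **THE ROOT RESIDUE AT ONE DIRECTION FROM THE BRIDGE AND A LONG RUN, FOR ANY SCHEME** `S : KSchA V ℕ` (root `t`, density `S.p`): the footprint tests
`FootOK`/`TgtOK` read vertices of the window ball into the root world `S.U0root du` resp. the target box `S.Γ.M a₀ (0 + du)`, the pinned seed lies in the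
root cube; otherwise the hypotheses of `rootOblTWAt_of_bridge`. [cite: KozmaNitzan2024, §4 p. 28 ((32) at the root), Lemma 11 (pp. 22–23), Lemma 12 (pp. 23–25)] -/
theorem rootOblTWAt_of_bridgeG (hlipφ : Lip G φ) (hlipL : Lip G ψL)
    (S : KSchA V ℕ) {t : V} (hroot : S.Γ.root = t) (du : MDir) {σ : ℤ} (hσ : σ = 1 ∨ σ = -1) {Rπ : ℕ}
    -- the scheme's membership tests: footprints in the world, in the target box
    (FootOK TgtOK : V → Prop) (hUfoot : ∀ w ∈ graphBall G t Rπ, FootOK w → w ∈ S.U0root du)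
    (hMfoot : ∀ w ∈ graphBall G t Rπ, TgtOK w → w ∈ S.Γ.M S.Γ.a₀ ((0 : Site 2) + stepVec du))
    -- the pinned seed
    {A : Finset V} (htA : t ∈ A) (hAconn : ∀ a ∈ A, PathIn G (↑A : Set V) t a) (hAπ : ∀ a ∈ A, a ∈ graphBall G t Rπ)
    (hAQ : A ⊆ S.Γ.Q S.Γ.a₀ 0)
    {kb : ℕ} (hAk : ∀ a ∈ A, |rootFrame φ t σ a 0| ≤ kb)
    -- the two frames and the chain data
    (B : BridgePrm) (hB : BridgeOK B) (S₂ : SchedFrame) (P₁ P₂ : WinChainData V)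
    (hPo₁ : P₁.o = t) (hPo₂ : P₂.o = t)
    (hPS₁ : P₁.Sfin = (S.U0root du).filter fun y => y ∈ graphBall G t Rπ)
    (hPS₂ : P₂.Sfin = (S.U0root du).filter fun y => y ∈ graphBall G t Rπ)
    (hRim₁ : ∀ k, P₁.Rim k ⊆ (planarWindowWin (lip_rootFrame hlipφ t hσ) t Rπ).stepDF (B.bridgeFrame hB) k)
    (hRim₂ : ∀ k, P₂.Rim k ⊆ (planarWindowWin hlipL t Rπ).stepDF S₂ k)
    (hRl₁ : P₁.Rlev + 1 ≤ B.R') (hRl₂ : P₂.Rlev + 1 ≤ S₂.R') (hj₁ : P₁.j₁ ≤ P₁.Rlev) (hj₂ : P₂.j₁ ≤ P₂.Rlev)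
    -- rooms: footprints of the regions and of the last core, clearances, nonempty targets, the cross link
    (hfoot₁ : ∀ w ∈ graphBall G t Rπ, rootFrame φ t σ w ∈ Finset.Icc B.regionLo B.regionHi → FootOK w)
    (hfoot₂ : ∀ k ≤ S₂.N, ∀ w ∈ graphBall G t Rπ, ψL w ∈ S₂.region k → FootOK w)
    (hclear₁ : (kb : ℤ) < B.B₀lo 0 - B.R' - B.pr)
    (hclear₂ : ∀ k ≤ S₂.N, ∀ w ∈ graphBall G t Rπ, ψL w ∈ S₂.region k → (kb : ℤ) < rootFrame φ t σ w 0)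
    (hTne₁ : (Win G (rootFrame φ t σ) t (Finset.Icc B.core1Lo B.core1Hi) Rπ).Nonempty)
    (hTne₂ : ∀ k ≤ S₂.N, (Win G ψL t (S₂.core (k + 1)) Rπ).Nonempty)
    (hx : ∀ w ∈ graphBall G t Rπ, rootFrame φ t σ w ∈ Finset.Icc B.core1Lo B.core1Hi → ψL w ∈ S₂.core 0)
    (hlastf : ∀ w ∈ graphBall G t Rπ, ψL w ∈ S₂.core (S₂.N + 1) → TgtOK w)
    -- the hop: one link input valid for `P_q`, its prism inside the ball with root-world footprints, its target inside the hop box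
    {Δ' : ℕ} {δr : ℕ → ℝ} {η : ℝ} {Qp T₀ : Finset V}
    (hlink : 1 - δr (0 + 1 + S₂.N) < (bondPercolation G S.p).real (linkIn (↑Qp : Set V) A T₀))
    (hQπ : ∀ w ∈ Qp, w ∈ graphBall G t Rπ) (hQfoot : ∀ w ∈ Qp, FootOK w)
    (hT₀ : ∀ w ∈ T₀, w ∈ graphBall G t Rπ ∧ rootFrame φ t σ w ∈ Finset.Icc B.B₀lo B.B₀hi)
    -- analytic inputs under the root-seed law (kits, counts, rim excesses) at accuracy `δr n`, `n = 1 + S₂.N`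
    (hcount₁ : 1 / (1 - (S.p : ℝ)) ^ (Δ' * P₁.N) ≤ δr (0 + 1 + S₂.N) * ((Finset.Icc P₁.j₀ P₁.j₁).card : ℝ))
    (hcount₂ : 1 / (1 - (S.p : ℝ)) ^ (Δ' * P₂.N) ≤ δr (0 + 1 + S₂.N) * ((Finset.Icc P₂.j₀ P₂.j₁).card : ℝ))
    (hkits₁ : ∀ k ≤ (B.bridgeFrame hB).N, ∀ j ∈ Finset.Icc P₁.j₀ P₁.j₁, ∃ (σk : SData V) (Sz : Finset V),
      SHyp (P₁.stepLF (planarWindowWin (lip_rootFrame hlipφ t hσ) t Rπ) (B.bridgeFrame hB) k) j σk ∧ σk.N ≤ P₁.N ∧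
      (1 - (S.p : ℝ) ^ σk.sB) ^ σk.k ≤ δr (0 + 1 + S₂.N) ∧ Sz ⊆ (P₁.stepLF (planarWindowWin (lip_rootFrame hlipφ t hσ) t Rπ) (B.bridgeFrame hB) k).X j ∧
      Sz ⊆ (planarWindowWin (lip_rootFrame hlipφ t hσ) t Rπ).stepDF (B.bridgeFrame hB) k ∧
      (∀ x ∈ σk.K, ∀ e' ∈ σk.seed x, e' ∉ wireSet (↑Sz : Set V)) ∧ (∀ x ∈ σk.K, σk.face x ⊆ Sz) ∧
      (∀ x ∈ σk.K, 1 - 3 * δr (0 + 1 + S₂.N) ≤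
        (prodBernoulli (S.W0pin G (edgesIn G A)
          ((S.U0root du).filter fun y => y ∈ graphBall G t Rπ))).real
        {ω | ∃ u ∈ σk.face x, 1 - δr (0 + 1 + S₂.N) <
          (prodBernoulli (pinW (S.W0pin G (edgesIn G A)
            ((S.U0root du).filter fun y => y ∈ graphBall G t Rπ)) (wireSet (↑Sz : Set V)) ω)).real
            (⋃ t' ∈ P₁.coreEF (planarWindowWin (lip_rootFrame hlipφ t hσ) t Rπ) (B.bridgeFrame hB) k,
              openConnIn (↑((planarWindowWin (lip_rootFrame hlipφ t hσ) t Rπ).stepDF (B.bridgeFrame hB) k) : Set V) u t')}))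
    (hkits₂ : ∀ k ≤ S₂.N, ∀ j ∈ Finset.Icc P₂.j₀ P₂.j₁, ∃ (σk : SData V) (Sz : Finset V),
      SHyp (P₂.stepLF (planarWindowWin hlipL t Rπ) S₂ k) j σk ∧ σk.N ≤ P₂.N ∧
      (1 - (S.p : ℝ) ^ σk.sB) ^ σk.k ≤ δr (0 + 1 + S₂.N) ∧ Sz ⊆ (P₂.stepLF (planarWindowWin hlipL t Rπ) S₂ k).X j ∧
      Sz ⊆ (planarWindowWin hlipL t Rπ).stepDF S₂ k ∧
      (∀ x ∈ σk.K, ∀ e' ∈ σk.seed x, e' ∉ wireSet (↑Sz : Set V)) ∧ (∀ x ∈ σk.K, σk.face x ⊆ Sz) ∧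
      (∀ x ∈ σk.K, 1 - 3 * δr (0 + 1 + S₂.N) ≤
        (prodBernoulli (S.W0pin G (edgesIn G A)
          ((S.U0root du).filter fun y => y ∈ graphBall G t Rπ))).real
        {ω | ∃ u ∈ σk.face x, 1 - δr (0 + 1 + S₂.N) <
          (prodBernoulli (pinW (S.W0pin G (edgesIn G A)
            ((S.U0root du).filter fun y => y ∈ graphBall G t Rπ)) (wireSet (↑Sz : Set V)) ω)).real
            (⋃ t' ∈ P₂.coreEF (planarWindowWin hlipL t Rπ) S₂ k, openConnIn (↑((planarWindowWin hlipL t Rπ).stepDF S₂ k) : Set V) u t')}))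
    (hη : η ≤ δr (0 + 1 + S₂.N) / 2)
    (hexc₁ : ∀ k ≤ (B.bridgeFrame hB).N, (prodBernoulli (S.W0pin G (edgesIn G A)
        ((S.U0root du).filter fun y => y ∈ graphBall G t Rπ))).real (⋃ t' ∈ P₁.Rim k, openConn t t') ≤ η)
    (hexc₂ : ∀ k ≤ S₂.N, (prodBernoulli (S.W0pin G (edgesIn G A)
        ((S.U0root du).filter fun y => y ∈ graphBall G t Rπ))).real (⋃ t' ∈ P₂.Rim k, openConn t t') ≤ η) :
    RootOblTWAt G S Δ' δr du := by
  subst hroot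
  set t : V := S.Γ.root with htdef
  set 𝒲₁ := planarWindowWin (lip_rootFrame hlipφ t hσ) t Rπ with h𝒲₁
  set 𝒲₂ := planarWindowWin hlipL t Rπ with h𝒲₂
  set S₁ := B.bridgeFrame hB with hS₁
  -- footprints ⟹ the root world / the target box
  have hU : ∀ {w : V}, w ∈ graphBall G t Rπ → FootOK w → w ∈ (S.U0root du).filter fun y => y ∈ graphBall G t Rπ := by
    intro w hw hf
    exact Finset.mem_filter.2 ⟨hUfoot _ hw hf, hw⟩
  -- regions of the bridge / long run: inside the world, off the seed
  have hDU₁ : ∀ k ≤ S₁.N, 𝒲₁.stepDF S₁ k ⊆ (S.U0root du).filter fun y => y ∈ graphBall G t Rπ := by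
    intro k hk w hw
    obtain rfl : k = 0 := Nat.le_zero.1 hk
    change w ∈ Win G (rootFrame φ t σ) t (S₁.region 0) Rπ at hw
    rw [mem_Win] at hw
    exact hU hw.1 (hfoot₁ w hw.1 (by simpa [hS₁] using hw.2))
  have hDU₂ : ∀ k ≤ S₂.N, 𝒲₂.stepDF S₂ k ⊆ (S.U0root du).filter fun y => y ∈ graphBall G t Rπ := by
    intro k hk w hw
    change w ∈ Win G ψL t (S₂.region k) Rπ at hw
    rw [mem_Win] at hw
    exact hU hw.1 (hfoot₂ k hk w hw.1 hw.2)
  have hDA₁ : ∀ k ≤ S₁.N, Disjoint (𝒲₁.stepDF S₁ k) A := by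
    intro k hk
    obtain rfl : k = 0 := Nat.le_zero.1 hk
    change Disjoint (Win G (rootFrame φ t σ) t (S₁.region 0) Rπ) A
    refine Finset.disjoint_left.2 fun w hw hwA => ?_
    rw [mem_Win] at hw
    have h1 : B.B₀lo 0 - B.R' - B.pr ≤ rootFrame φ t σ w 0 := BridgePrm.le_of_mem_region (by simpa [hS₁] using hw.2) 0
    have h2 := (abs_le.1 (hAk w hwA)).2
    linarith
  have hDA₂ : ∀ k ≤ S₂.N, Disjoint (𝒲₂.stepDF S₂ k) A := by
    intro k hk
    change Disjoint (Win G ψL t (S₂.region k) Rπ) A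
    refine Finset.disjoint_left.2 fun w hw hwA => ?_
    rw [mem_Win] at hw
    have h1 := hclear₂ k hk w hw.1 hw.2
    have h2 := (abs_le.1 (hAk w hwA)).2
    linarith
  -- nonempty true targets
  have hTne₁' : ∀ k ≤ S₁.N, (𝒲₁.coreTF S₁ k).Nonempty := by
    intro k hk
    obtain rfl : k = 0 := Nat.le_zero.1 hk
    change (Win G (rootFrame φ t σ) t (S₁.core (0 + 1)) Rπ).Nonempty
    simpa [hS₁] using hTne₁
  have hTne₂' : ∀ k ≤ S₂.N, (𝒲₂.coreTF S₂ k).Nonempty := fun k hk => hTne₂ k hk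
  -- the cross link and the last core
  have hx' : 𝒲₁.coreTF S₁ S₁.N ⊆ 𝒲₂.W (S₂.core 0) := by
    intro w hw
    change w ∈ Win G (rootFrame φ t σ) t (S₁.core (S₁.N + 1)) Rπ at hw
    change w ∈ Win G ψL t (S₂.core 0) Rπ
    rw [mem_Win] at hw ⊢
    exact ⟨hw.1, hx w hw.1 (by simpa [hS₁] using hw.2)⟩
  have hlast : 𝒲₂.coreTF S₂ S₂.N ⊆ S.Γ.M S.Γ.a₀ ((0 : Site 2) + stepVec du) := by
    intro w hw
    change w ∈ Win G ψL t (S₂.core (S₂.N + 1)) Rπ at hw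
    rw [mem_Win] at hw
    exact hMfoot w hw.1 (hlastf w hw.1 hw.2)
  -- the hop's prism inside the world, its target inside the first level
  have hQU : Qp ⊆ (S.U0root du).filter fun y => y ∈ graphBall G t Rπ := fun w hw => hU (hQπ w hw) (hQfoot w hw)
  have hT₀' : T₀ ⊆ 𝒲₁.W (S₁.core 0) := by
    intro w hw
    obtain ⟨hπ, hbox⟩ := hT₀ w hw
    change w ∈ Win G (rootFrame φ t σ) t (S₁.core 0) Rπ
    rw [mem_Win]
    exact ⟨hπ, by simpa [hS₁] using hbox⟩
  have hN : S₁.N + 1 + S₂.N = 0 + 1 + S₂.N := by simp [hS₁]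
  -- assemble
  refine Skel.rootOblTWAt_of_chain₂ (S := S) hAQ hAπ htA hAconn 𝒲₁ 𝒲₂ S₁ S₂ P₁ P₂ hPo₁ hPo₂ hPS₁ hPS₂ hRim₁ hRim₂ hRl₁ hRl₂ hj₁ hj₂
    hTne₁' hTne₂' hDU₁ hDU₂ hDA₁ hDA₂ hx' hlast (hN ▸ hlink) hQU hT₀' (hN ▸ hcount₁) (hN ▸ hcount₂) (hN ▸ hkits₁) (hN ▸ hkits₂) (hN ▸ hη)
    hexc₁ hexc₂

end Skelφ

end Transplant

end Summit.CriticalPhenomena.PercolationContinuityZ3.Theorems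

end
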